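/-
Copyright (c) 2026 the pub-hodgecm-mathlib formalisation cell (harness21).  Prover seat hodgecm-mathlib-K2E4-p01 (g3), Track B ∕ K2-LIT,
h413 = `stmt-HodgeConjecture-24833`; road «#22S ⟸ (GS_v) + (LIFT_v)» (K2E4-p18 (g2) REPORT-22 §3), FILE E = the explicit germ engine behind
(GS^P) `K2/K2E4-p01/g3/GSP.sig.lean`.  2026-09-04.
-/
import Summits.HodgeConjecture.HodgeConjecture.Theorems.K2E3GLTwoCentralDensityRamifiedTorus   -- ★ lineage g2: FILES A (shell shift), B1∕B2 (shell sum), C1 (compact core), C2 ((HC₁^P))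
import HarnessLib

/-!
# h413 ∕ Track B «K2-LIT» — FILE E: the EXPLICIT TWO-TERM GERM of the canonical orbital integrals of `P = GL₂(F) × GL₁(F)` along the
# ramified elliptic ray `γ_n = z(1 + ϖⁿτ)` (closed form of the Labesse–Langlands shell recursion `S_{n+1} = q·S_n + ψ(z·1₂, c)`)

Cell `pub/hodgecm-mathlib`, crux H413 = `stmt-HodgeConjecture-24833` (supports-only).  Socket #22S `sig_K2E4WeakMatrixFiniteTransportSplit`
(WMR ED. 3 :447) is paid by ★ p855355 `weakMatrixFiniteTransportSplit_of_germStructure` modulo the two in-print inputs (GS_v) «central germ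
structure at a split place» and (LIFT_v) (K2E4-p18 (g2) REPORT-22 §3, cand bytes `K2/K2E4-p18/g2/sig_K2E4Socket22Inputs.cand…lean`).  (GS_v) is
the frame transport (T0-style) of the `P`-side statement (GS^P) `K2E3GLTwoCentralGermRamifiedRay.exists_ellipticRay_orbitalIntegral_eq_add_mul`;
THIS FILE is its engine, for `K_P`-CONJUGATION-INVARIANT test functions (the general case is a finite `K_P`-average, next file):

* §1 `measure_stabOne_eq_one`, **`orbitalIntegral_deep_eq_mul_sum`** — under the canonical normalisation `ρ(compactCore C_P((γ_n, c))) = 1` the weight of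
  the lineage's shell sum ★ `orbitalIntegral_eq_sum_range_shell` is `ν(K_P)∕ρ(A₀) = ν(K_P)` (`A₀ = C ∩ K_P = compactCore`, ★ `compactCore_centralizer_pair_eq`),
  INDEPENDENT of `n`: `O_{(γ_n,c)}^{ν∕ρ}(ψ) = ν(K_P) · Σ_{r<R} q^r ψ(X_r (γ_n, c) X_r⁻¹)`.
* §2 `apply_shellConj_succ_succ_eq`, `apply_shellConj_succ_zero_eq`, `apply_shellConj_eq_zero_of_le` — the shell shift of ★ FILE A read on a
  right-`K(ϖ^m)`-invariant `ψ` (term `r+1` at depth `n+1` = term `r` at depth `n`, term `0` at depth `n+1` = `ψ(z·1₂, c)`, `n ≥ m`) and the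
  propagation of the support bound (`R` at depth `m` ⇒ `R + k` at depth `m + k`).
* §3 **`orbitalIntegral_deep_eq_closedForm`** — THE EXPLICIT GERM: for all `k` and every normalised `ρ`,
  `O_{(γ_{m+k}, c)}^{ν∕ρ}(ψ) = ν(K_P) · (q^k · (S_m + ψ(z·1₂,c)∕(q−1)) − ψ(z·1₂,c)∕(q−1))`, `S_m = Σ_{r<R} q^r ψ(X_r (γ_m, c) X_r⁻¹)` —
  i.e. `O = a + b·qⁿ` with `ψ(z·1₂, c) = −((q−1)∕ν(K_P))·a` (the constant term carries the central value: `Γ₁^{T_ram} ≠ 0`).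
* §4 `tendsto_deep` — `(γ_n, c) → (z·1₂, c)` (`γ_n ∈ z·K(ϖⁿ)`, ★ `exists_congruenceGL_pow_subset`); `conj_mem_congruenceGL_of_mem_glInt` (`K(ϖ^m) ⊴ GL₂(𝒪)`).

HONEST LABEL: HC_CM is proved only modulo the 7 printed citations (2 remaining named inputs: hLiu418 = `stmt-HodgeConjecture-24832`,
h413 = `stmt-HodgeConjecture-24833`) until rung 0 closes; this file is an unconditional local computation and moves no counter by itself.

## References
* [LabesseLanglands1979] J.-P. Labesse, R. P. Langlands, *L-indistinguishability for SL(2)*, Canad. J. Math. 31 (1979), §2 pp. 7–9 (shell sums `δ_m ∝ q^m`).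
* [HarishChandra1999AdmissibleDistributions] Harish-Chandra (DeBacker–Sally), *Admissible Invariant Distributions on Reductive p-adic Groups*, AMS ULS 16
  (1999), Thm. 3.1 (germ expansion).
* [Rogawski1990] J. D. Rogawski, *Automorphic Representations of Unitary Groups in Three Variables* (1990), §8.1 pp. 114–116 (`Γ₁^T = (−1)^{q(T)} d⁻¹ ≠ 0`), §4.9 p. 54.
-/

set_option autoImplicit false
set_option linter.dupNamespace false

noncomputable section

open scoped ValuativeRel Matrix MatrixGroups ENNReal
open Matrix ValuativeRel MeasureTheory Measure Topology Filter
open Literature.MeasureTheory.Group Literature.NumberTheory.Automorphic Literature.NumberTheory.Automorphic.HermitianLatticeTree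
open Literature.NumberTheory.Rogawski1990 (IsLocSmooth)
open Summit.HodgeConjecture.HodgeConjecture.Cruxes.H413.K2E3GLTwoRamifiedShellShift
open Summit.HodgeConjecture.HodgeConjecture.Cruxes.H413.K2E3GLTwoRamifiedShellStabilizers
open Summit.HodgeConjecture.HodgeConjecture.Cruxes.H413.K2E3GLTwoRamifiedShellUnfolding
open Summit.HodgeConjecture.HodgeConjecture.Cruxes.H413.K2E3GLTwoRamifiedTorusCompactCore

namespace Summit.HodgeConjecture.HodgeConjecture.Cruxes.H413.K2E3GLTwoRamifiedRayGermEngine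

variable {F : Type*} [Field F] [ValuativeRel F] [TopologicalSpace F] [IsNonarchimedeanLocalField F]

/-! ## §4 (first, measure-free) `K(ϖ^m)` is normalised by `GL₂(𝒪)`; the ray converges to the centre -/

section Algebra

variable {ϖ : F} (hϖ : IsUniformizingElement ϖ)

omit [TopologicalSpace F] [IsNonarchimedeanLocalField F] in
/-- **`GL_n(𝒪)` normalises the principal congruence subgroups**: `k g k⁻¹ ∈ K(δ)` for `k ∈ GL_n(𝒪)`, `g ∈ K(δ)` (entrywise valuation bounds are stable
under multiplication by integral matrices). [folklore] [cite: LabesseLanglands1979, §2 p. 7] -/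
theorem conj_mem_congruenceGL_of_mem_glInt {N : ℕ} {δ : ValueGroupWithZero F} {k g : GL (Fin N) F} (hk : k ∈ glInt N F)
    (hg : g ∈ congruenceGL N δ) : k * g * k⁻¹ ∈ congruenceGL N δ := by
  rw [mem_glInt_iff] at hk
  have hk1 : ValBound 1 (k : Matrix (Fin N) (Fin N) F) := fun i j => (Valuation.mem_integer_iff _ _).1 (hk.1 i j)
  have hk2 : ValBound 1 ((k⁻¹ : GL (Fin N) F) : Matrix (Fin N) (Fin N) F) := fun i j => (Valuation.mem_integer_iff _ _).1 (hk.2 i j)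
  obtain ⟨⟨hg1, hg2⟩, hg3, hg4⟩ := mem_congruenceGL_iff.1 hg
  have hinv : (k * g * k⁻¹)⁻¹ = k * g⁻¹ * k⁻¹ := by group
  have hval : ∀ g' : GL (Fin N) F, ((k * g' * k⁻¹ : GL (Fin N) F) : Matrix (Fin N) (Fin N) F) =
      (k : Matrix (Fin N) (Fin N) F) * (g' : Matrix (Fin N) (Fin N) F) * ((k⁻¹ : GL (Fin N) F) : Matrix (Fin N) (Fin N) F) := fun g' => by
    rw [Units.val_mul, Units.val_mul]
  have hsub : ∀ g' : GL (Fin N) F, ((k * g' * k⁻¹ : GL (Fin N) F) : Matrix (Fin N) (Fin N) F) - 1 =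
      (k : Matrix (Fin N) (Fin N) F) * ((g' : Matrix (Fin N) (Fin N) F) - 1) * ((k⁻¹ : GL (Fin N) F) : Matrix (Fin N) (Fin N) F) := fun g' => by
    rw [Units.val_mul, Units.val_mul, Matrix.mul_sub, Matrix.sub_mul, Matrix.mul_one, Units.mul_inv]
  refine mem_congruenceGL_iff.2 ⟨⟨?_, ?_⟩, ?_, ?_⟩
  · rw [hval]; simpa using (hk1.mul hg1).mul hk2
  · rw [hinv, hval]; simpa using (hk1.mul hg2).mul hk2
  · rw [hsub]; simpa using (hk1.mul hg3).mul hk2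
  · rw [hinv, hsub]; simpa using (hk1.mul hg4).mul hk2

/-! ## §2 The shell shift read on a right-`K(ϖ^m)`-invariant test function; propagation of the support bound -/

omit [TopologicalSpace F] [IsNonarchimedeanLocalField F] in
include hϖ in
/-- **Shell shift, term by term**: for `n ≥ m` and `ψ` right-`K(ϖ^m)`-invariant in the `GL₂` variable, the `(r+1)`-st shell value at depth `n+1` equals the
`r`-th shell value at depth `n` (★ FILE A `exists_shellConj_succ_eq_mul_of_mem_congruenceGL`). [cite: LabesseLanglands1979, §2 p. 8] -/
theorem apply_shellConj_succ_succ_eq {u v : F} (hu : u ∈ 𝒪[F]) (hv : v ∈ 𝒪[F]) (z : F) (cu : GL (Fin 1) F)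
    {γ : ℕ → GL (Fin 2) F} (hγ : ∀ n, (γ n : Matrix (Fin 2) (Fin 2) F) = !![z, z * ϖ ^ n * v; z * ϖ ^ n, z + z * ϖ ^ n * u])
    {rm : ℕ → GL (Fin 2) F} (hrm : ∀ m, (rm m : Matrix (Fin 2) (Fin 2) F) = Matrix.diagonal ![1, ϖ ^ m])
    {ψ : GL (Fin 2) F × GL (Fin 1) F → ℂ} {m : ℕ} (hm : 1 ≤ m)
    (hright : ∀ k ∈ congruenceGL 2 (valuation F ϖ ^ m), ∀ x : GL (Fin 2) F, ψ (x * k, cu) = ψ (x, cu))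
    {n : ℕ} (hn : m ≤ n) (r : ℕ) :
    ψ ((((rm (r + 1))⁻¹, 1) : GL (Fin 2) F × GL (Fin 1) F) * (γ (n + 1), cu) * (((rm (r + 1))⁻¹, 1) : GL (Fin 2) F × GL (Fin 1) F)⁻¹) =
      ψ ((((rm r)⁻¹, 1) : GL (Fin 2) F × GL (Fin 1) F) * (γ n, cu) * (((rm r)⁻¹, 1) : GL (Fin 2) F × GL (Fin 1) F)⁻¹) := by
  have hXconj : ∀ n r, (((rm r)⁻¹, 1) : GL (Fin 2) F × GL (Fin 1) F) * (γ n, cu) * (((rm r)⁻¹, 1) : GL (Fin 2) F × GL (Fin 1) F)⁻¹ =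
      ((rm r)⁻¹ * γ n * rm r, cu) := fun n r => by
    simp only [Prod.mk_mul_mk, Prod.inv_mk, inv_inv, one_mul, inv_one, mul_one]
  obtain ⟨k, hk, hkeq⟩ := exists_shellConj_succ_eq_mul_of_mem_congruenceGL hϖ hu hv z (hm.trans hn) r (hγ n) (hγ (n + 1)) (hrm r) (hrm (r + 1))
  have hk' : k ∈ congruenceGL 2 (valuation F ϖ ^ m) := congruenceGL_mono (pow_le_pow_right_of_le_one' hϖ.valuation_le_one hn) hk
  rw [hXconj, hXconj, hkeq, hright k hk']

omit [TopologicalSpace F] [IsNonarchimedeanLocalField F] in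
include hϖ in
/-- **The innermost shell at depth `n + 1 ≥ m` is the central value**: `ψ(X_0 (γ_{n+1}, c) X_0⁻¹) = ψ(z·1₂, c)` (`γ_{n+1} ∈ (z·1₂)·K(ϖ^{n+1})`, ★ FILE A).
[cite: LabesseLanglands1979, §2 p. 8] -/
theorem apply_shellConj_succ_zero_eq {u v : F} (hu : u ∈ 𝒪[F]) (hv : v ∈ 𝒪[F]) (z : F) (cu : GL (Fin 1) F)
    {γ : ℕ → GL (Fin 2) F} (hγ : ∀ n, (γ n : Matrix (Fin 2) (Fin 2) F) = !![z, z * ϖ ^ n * v; z * ϖ ^ n, z + z * ϖ ^ n * u])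
    {rm : ℕ → GL (Fin 2) F} (hrm : ∀ m, (rm m : Matrix (Fin 2) (Fin 2) F) = Matrix.diagonal ![1, ϖ ^ m])
    {zS : GL (Fin 2) F} (hzS : (zS : Matrix (Fin 2) (Fin 2) F) = !![z, 0; 0, z])
    {ψ : GL (Fin 2) F × GL (Fin 1) F → ℂ} {m : ℕ}
    (hright : ∀ k ∈ congruenceGL 2 (valuation F ϖ ^ m), ∀ x : GL (Fin 2) F, ψ (x * k, cu) = ψ (x, cu))
    {n : ℕ} (hn : m ≤ n) :
    ψ ((((rm 0)⁻¹, 1) : GL (Fin 2) F × GL (Fin 1) F) * (γ (n + 1), cu) * (((rm 0)⁻¹, 1) : GL (Fin 2) F × GL (Fin 1) F)⁻¹) = ψ (zS, cu) := by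
  obtain ⟨k, hk, hkeq⟩ := exists_deep_eq_scalar_mul_of_mem_congruenceGL hϖ hu hv z (n := n + 1) (by omega) (hγ (n + 1)) hzS
  have hk' : k ∈ congruenceGL 2 (valuation F ϖ ^ m) :=
    congruenceGL_mono (pow_le_pow_right_of_le_one' hϖ.valuation_le_one (hn.trans (Nat.le_succ n))) hk
  rw [shellRep_zero_eq_one hrm, one_mul, inv_one, mul_one, hkeq, hright k hk']

omit [TopologicalSpace F] [IsNonarchimedeanLocalField F] in
include hϖ in
/-- **Propagation of the support bound along the ray**: if the shell values of `ψ` at depth `m` vanish from shell `R` on, then at depth `m + k` they vanish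
from shell `R + k` on (iterate the shell shift). [cite: LabesseLanglands1979, §2 p. 8] -/
theorem apply_shellConj_eq_zero_of_le {u v : F} (hu : u ∈ 𝒪[F]) (hv : v ∈ 𝒪[F]) (z : F) (cu : GL (Fin 1) F)
    {γ : ℕ → GL (Fin 2) F} (hγ : ∀ n, (γ n : Matrix (Fin 2) (Fin 2) F) = !![z, z * ϖ ^ n * v; z * ϖ ^ n, z + z * ϖ ^ n * u])
    {rm : ℕ → GL (Fin 2) F} (hrm : ∀ m, (rm m : Matrix (Fin 2) (Fin 2) F) = Matrix.diagonal ![1, ϖ ^ m])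
    {ψ : GL (Fin 2) F × GL (Fin 1) F → ℂ} {m : ℕ} (hm : 1 ≤ m)
    (hright : ∀ k ∈ congruenceGL 2 (valuation F ϖ ^ m), ∀ x : GL (Fin 2) F, ψ (x * k, cu) = ψ (x, cu))
    {R : ℕ} (hR : ∀ r, R ≤ r → ψ ((((rm r)⁻¹, 1) : GL (Fin 2) F × GL (Fin 1) F) * (γ m, cu) * (((rm r)⁻¹, 1) : GL (Fin 2) F × GL (Fin 1) F)⁻¹) = 0)
    (k : ℕ) : ∀ r, R + k ≤ r →
      ψ ((((rm r)⁻¹, 1) : GL (Fin 2) F × GL (Fin 1) F) * (γ (m + k), cu) * (((rm r)⁻¹, 1) : GL (Fin 2) F × GL (Fin 1) F)⁻¹) = 0 := by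
  induction k with
  | zero => simpa using hR
  | succ k ih =>
    intro r hr
    obtain ⟨r', rfl⟩ : ∃ r', r = r' + 1 := ⟨r - 1, by omega⟩
    rw [← add_assoc, apply_shellConj_succ_succ_eq hϖ hu hv z cu hγ hrm hm hright (Nat.le_add_right m k) r']
    exact ih r' (by omega)

include hϖ in
/-- **The ray converges to the centre**: `(γ_n, c) → (z·1₂, c)` in `P`, because `γ_n = (z·1₂)·k_n` with `k_n ∈ K(ϖⁿ)` (★ FILE A) and the principal
congruence subgroups shrink to `1` (★ `exists_congruenceGL_pow_subset`). [cite: LabesseLanglands1979, §2 p. 8] -/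
theorem tendsto_deep {u v : F} (hu : u ∈ 𝒪[F]) (hv : v ∈ 𝒪[F]) (z : F) (cu : GL (Fin 1) F)
    {γ : ℕ → GL (Fin 2) F} (hγ : ∀ n, (γ n : Matrix (Fin 2) (Fin 2) F) = !![z, z * ϖ ^ n * v; z * ϖ ^ n, z + z * ϖ ^ n * u])
    {zS : GL (Fin 2) F} (hzS : (zS : Matrix (Fin 2) (Fin 2) F) = !![z, 0; 0, z]) :
    Tendsto (fun n => ((γ n, cu) : GL (Fin 2) F × GL (Fin 1) F)) atTop (𝓝 (zS, cu)) := by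
  -- `k_n := zS⁻¹ γ_n ∈ K(ϖⁿ)` for `n ≥ 1`
  have hk : ∀ n, 1 ≤ n → zS⁻¹ * γ n ∈ congruenceGL 2 (valuation F ϖ ^ n) := fun n hn => by
    obtain ⟨k, hk, hγk⟩ := exists_deep_eq_scalar_mul_of_mem_congruenceGL hϖ hu hv z hn (hγ n) hzS
    rw [hγk, inv_mul_cancel_left]
    exact hk
  have hk1 : Tendsto (fun n => zS⁻¹ * γ n) atTop (𝓝 1) := by
    rw [tendsto_atTop_nhds]
    intro U h1U hUo
    obtain ⟨m, hm, hmU⟩ := exists_congruenceGL_pow_subset hϖ (hUo.mem_nhds h1U)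
    refine ⟨m, fun n hn => hmU ?_⟩
    exact congruenceGL_mono (pow_le_pow_right_of_le_one' hϖ.valuation_le_one hn) (hk n (hm.trans hn))
  have hγ' : (fun n => ((γ n, cu) : GL (Fin 2) F × GL (Fin 1) F)) = fun n => ((zS, cu) : GL (Fin 2) F × GL (Fin 1) F) * (zS⁻¹ * γ n, 1) := by
    funext n
    simp only [Prod.mk_mul_mk, mul_inv_cancel_left, mul_one]
  rw [hγ']
  have h2 : Tendsto (fun n => ((zS⁻¹ * γ n, 1) : GL (Fin 2) F × GL (Fin 1) F)) atTop (𝓝 (1, 1)) :=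
    hk1.prodMk_nhds tendsto_const_nhds
  have h3 := (continuous_const_mul ((zS, cu) : GL (Fin 2) F × GL (Fin 1) F)).tendsto _ |>.comp h2
  simpa only [Function.comp_def, Prod.mk_one_one, mul_one] using h3

end Algebra

/-! ## §1 The weight of the shell sum under the canonical normalisation -/

section Engine

variable [MeasurableSpace (GL (Fin 2) F × GL (Fin 1) F)] [BorelSpace (GL (Fin 2) F × GL (Fin 1) F)]
  [T2Space (GL (Fin 2) F × GL (Fin 1) F)] [LocallyCompactSpace (GL (Fin 2) F × GL (Fin 1) F)]
  [SecondCountableTopology (GL (Fin 2) F × GL (Fin 1) F)]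
  [∀ Γ : GL (Fin 2) F × GL (Fin 1) F, MeasurableSpace ((GL (Fin 2) F × GL (Fin 1) F) ⧸ Subgroup.centralizer ({Γ} : Set (GL (Fin 2) F × GL (Fin 1) F)))]
  [∀ Γ : GL (Fin 2) F × GL (Fin 1) F, BorelSpace ((GL (Fin 2) F × GL (Fin 1) F) ⧸ Subgroup.centralizer ({Γ} : Set (GL (Fin 2) F × GL (Fin 1) F)))]
  {ϖ : F} (hϖ : IsUniformizingElement ϖ)

omit [BorelSpace (GL (Fin 2) F × GL (Fin 1) F)] [LocallyCompactSpace (GL (Fin 2) F × GL (Fin 1) F)] [SecondCountableTopology (GL (Fin 2) F × GL (Fin 1) F)]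
  [∀ Γ : GL (Fin 2) F × GL (Fin 1) F, MeasurableSpace ((GL (Fin 2) F × GL (Fin 1) F) ⧸ Subgroup.centralizer ({Γ} : Set (GL (Fin 2) F × GL (Fin 1) F)))]
  [∀ Γ : GL (Fin 2) F × GL (Fin 1) F, BorelSpace ((GL (Fin 2) F × GL (Fin 1) F) ⧸ Subgroup.centralizer ({Γ} : Set (GL (Fin 2) F × GL (Fin 1) F)))] in
include hϖ in
/-- **`ρ(A₀) = 1` under the canonical normalisation**: the stabiliser `A₀ = {c ∈ C | c ∈ K_P}` of the trivial shell (written as the stabiliser of `X = 1`)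
is the compact core `C ∩ K_P` of `C = C_P((γ, a))` (★ `compactCore_centralizer_pair_eq`), so `ρ(A₀) = ρ(compactCore) = 1`.
[cite: Rogawski1990, §4.3 p. 43] [cite: LabesseLanglands1979, §2 p. 7] -/
theorem measure_stabOne_eq_one {u v : F} (hu : u ∈ 𝒪[F]) (hu1 : valuation F u < 1) (hv1 : valuation F v = valuation F ϖ)
    {γτ γ : GL (Fin 2) F} (hγτ : (γτ : Matrix (Fin 2) (Fin 2) F) = !![0, v; 1, u])
    (hC : Subgroup.centralizer ({γ} : Set (GL (Fin 2) F)) = Subgroup.centralizer ({γτ} : Set (GL (Fin 2) F))) (a : GL (Fin 1) F)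
    (ρ : Measure (Subgroup.centralizer ({(γ, a)} : Set (GL (Fin 2) F × GL (Fin 1) F))))
    (hρ : ρ (compactCore (Subgroup.centralizer ({(γ, a)} : Set (GL (Fin 2) F × GL (Fin 1) F)))) = 1) :
    ρ ((((glInt 2 F).prod (glInt 1 F)).comap ((MulAut.conj (1 : GL (Fin 2) F × GL (Fin 1) F)).toMonoidHom.comp
        (Subgroup.centralizer ({(γ, a)} : Set (GL (Fin 2) F × GL (Fin 1) F))).subtype) :
        Set (Subgroup.centralizer ({(γ, a)} : Set (GL (Fin 2) F × GL (Fin 1) F))))) = 1 := by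
  have hA1 : (((glInt 2 F).prod (glInt 1 F)).comap ((MulAut.conj (1 : GL (Fin 2) F × GL (Fin 1) F)).toMonoidHom.comp
        (Subgroup.centralizer ({(γ, a)} : Set (GL (Fin 2) F × GL (Fin 1) F))).subtype) :
        Set (Subgroup.centralizer ({(γ, a)} : Set (GL (Fin 2) F × GL (Fin 1) F)))) =
      (((glInt 2 F).prod (glInt 1 F)).subgroupOf (Subgroup.centralizer ({(γ, a)} : Set (GL (Fin 2) F × GL (Fin 1) F))) :
        Set (Subgroup.centralizer ({(γ, a)} : Set (GL (Fin 2) F × GL (Fin 1) F)))) := by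
    ext x; rw [SetLike.mem_coe, mem_stab_iff, one_mul, inv_one, mul_one, SetLike.mem_coe, Subgroup.mem_subgroupOf]
  rw [hA1, ← compactCore_centralizer_pair_eq hϖ hu hu1 hv1 hγτ hC a, hρ]

include hϖ in
/-- **THE SHELL SUM WITH ITS CANONICAL WEIGHT** (★ FILE B2 + §1): for `ψ ∈ C_c(P)` invariant under `K_P`-conjugation, `Γ = (γ, a)` on an Eisenstein
torus with closed class, a shell bound `R` of the support and EVERY Haar `ρ` on `C_P(Γ)` with `ρ(compactCore) = 1`:
`O_Γ^{ν∕ρ}(ψ) = ν(K_P) · Σ_{r<R} q^r · ψ(X_r Γ X_r⁻¹)` — the weight does not depend on `Γ`.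
[cite: LabesseLanglands1979, §2 p. 8] [cite: Rogawski1990, §4.9 p. 54] -/
theorem orbitalIntegral_eq_mul_sum_shell {u v : F} (hu : u ∈ 𝒪[F]) (hu1 : valuation F u < 1) (hv1 : valuation F v = valuation F ϖ)
    {γτ γ : GL (Fin 2) F} (hγτ : (γτ : Matrix (Fin 2) (Fin 2) F) = !![0, v; 1, u])
    (hC : Subgroup.centralizer ({γ} : Set (GL (Fin 2) F)) = Subgroup.centralizer ({γτ} : Set (GL (Fin 2) F))) (a : GL (Fin 1) F)
    {rm : ℕ → GL (Fin 2) F} (hrm : ∀ m, (rm m : Matrix (Fin 2) (Fin 2) F) = Matrix.diagonal ![1, ϖ ^ m])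
    (hO : IsClosed {g : GL (Fin 2) F × GL (Fin 1) F | ∃ y : GL (Fin 2) F × GL (Fin 1) F, y * (γ, a) * y⁻¹ = g})
    {ψ : GL (Fin 2) F × GL (Fin 1) F → ℂ} (hψc : Continuous ψ) (hψs : HasCompactSupport ψ)
    (hψK : ∀ k ∈ (glInt 2 F).prod (glInt 1 F), ∀ y, ψ (k * y * k⁻¹) = ψ y)
    (ρ : Measure (Subgroup.centralizer ({(γ, a)} : Set (GL (Fin 2) F × GL (Fin 1) F)))) [ρ.IsHaarMeasure] [ρ.IsInvInvariant]
    (hρ : ρ (compactCore (Subgroup.centralizer ({(γ, a)} : Set (GL (Fin 2) F × GL (Fin 1) F)))) = 1)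
    (ν : Measure (GL (Fin 2) F × GL (Fin 1) F)) [ν.IsHaarMeasure] [ν.IsMulRightInvariant]
    {R : ℕ} (hR : ∀ r, R ≤ r → ψ ((((rm r)⁻¹, 1) : GL (Fin 2) F × GL (Fin 1) F) * (γ, a) * (((rm r)⁻¹, 1) : GL (Fin 2) F × GL (Fin 1) F)⁻¹) = 0) :
    orbitalIntegral (γ, a) ψ (quotientMeasure (Subgroup.centralizer ({(γ, a)} : Set (GL (Fin 2) F × GL (Fin 1) F))) ρ
        (isClosed_coe_centralizer_singleton (γ, a)) ν) =
      ((ν ((glInt 2 F).prod (glInt 1 F))).toReal : ℂ) *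
        ∑ r ∈ Finset.range R, ((Nat.card (IsLocalRing.ResidueField 𝒪[F]) : ℂ) ^ r) *
          ψ ((((rm r)⁻¹, 1) : GL (Fin 2) F × GL (Fin 1) F) * (γ, a) * (((rm r)⁻¹, 1) : GL (Fin 2) F × GL (Fin 1) F)⁻¹) := by
  haveI : LocallyCompactSpace (Subgroup.centralizer ({(γ, a)} : Set (GL (Fin 2) F × GL (Fin 1) F))) :=
    (isClosed_coe_centralizer_singleton (γ, a)).isClosedEmbedding_subtypeVal.locallyCompactSpace
  rw [orbitalIntegral_eq_sum_range_shell hϖ hu hu1 hv1 hγτ hC a hrm hO hψc hψs hψK ρ ν hR, measure_stabOne_eq_one hϖ hu hu1 hv1 hγτ hC a ρ hρ,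
    div_one, Finset.mul_sum]
  refine Finset.sum_congr rfl fun r _ => ?_
  rw [Complex.real_smul, Complex.ofReal_mul, Complex.ofReal_pow, Complex.ofReal_natCast, mul_assoc]

/-! ## §3 THE EXPLICIT GERM (closed form of `S_{n+1} = q·S_n + ψ(z·1₂, c)`) -/

include hϖ in
/-- **THE EXPLICIT TWO-TERM GERM ON THE RAMIFIED RAY.**  Let `τ² = uτ + v` be an Eisenstein torus (`u ∈ 𝔭`, `|v| = |ϖ|`), `γ_n = z(1 + ϖⁿτ)`,
`ψ ∈ C_c(P)` invariant under `K_P`-conjugation and right-`K(ϖ^m)`-invariant in the `GL₂` variable (`m ≥ 1`), `R` a shell bound of its support at depth `m`,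
`S := Σ_{r<R} q^r ψ(X_r (γ_m, c) X_r⁻¹)` and `ψ₀ := ψ(z·1₂, c)`.  Then for every `k` and every Haar `ρ` on `C_P((γ_{m+k}, c))` with `ρ(compactCore) = 1`:
`O_{(γ_{m+k}, c)}^{ν∕ρ}(ψ) = ν(K_P) · (q^k · (S + ψ₀∕(q−1)) − ψ₀∕(q−1))`.
So along the ray the canonical orbital integral is EXACTLY `a + b·qⁿ` with `a = −ν(K_P)·ψ₀∕(q−1)`: the constant term carries the central value
(`Γ₁^{T} ≠ 0` for the ramified torus — the content of Rogawski's `Γ₁ = (−1)^q d⁻¹`), the `qⁿ ≍ |D(γ_n)|^{-1∕2}`-term is the regular-unipotent germ.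
[cite: LabesseLanglands1979, §2 pp. 8–9] [cite: HarishChandra1999AdmissibleDistributions, Thm. 3.1] [cite: Rogawski1990, §8.1 p. 116] -/
theorem orbitalIntegral_deep_eq_closedForm {u v : F} (hu : u ∈ 𝒪[F]) (hu1 : valuation F u < 1) (hv1 : valuation F v = valuation F ϖ)
    (hdisc : u ^ 2 + 4 * v ≠ 0) (z : Fˣ) (cu : GL (Fin 1) F)
    {γτ : GL (Fin 2) F} (hγτ : (γτ : Matrix (Fin 2) (Fin 2) F) = !![0, v; 1, u])
    {γ : ℕ → GL (Fin 2) F} (hγ : ∀ n, (γ n : Matrix (Fin 2) (Fin 2) F) = !![(z : F), z * ϖ ^ n * v; z * ϖ ^ n, z + z * ϖ ^ n * u])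
    {rm : ℕ → GL (Fin 2) F} (hrm : ∀ m, (rm m : Matrix (Fin 2) (Fin 2) F) = Matrix.diagonal ![1, ϖ ^ m])
    {zS : GL (Fin 2) F} (hzS : (zS : Matrix (Fin 2) (Fin 2) F) = !![(z : F), 0; 0, z])
    (ν : Measure (GL (Fin 2) F × GL (Fin 1) F)) [ν.IsHaarMeasure] [ν.IsMulRightInvariant]
    {ψ : GL (Fin 2) F × GL (Fin 1) F → ℂ} (hψc : Continuous ψ) (hψs : HasCompactSupport ψ)
    (hψK : ∀ k ∈ (glInt 2 F).prod (glInt 1 F), ∀ y, ψ (k * y * k⁻¹) = ψ y)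
    {m : ℕ} (hm : 1 ≤ m) (hright : ∀ k ∈ congruenceGL 2 (valuation F ϖ ^ m), ∀ x : GL (Fin 2) F, ψ (x * k, cu) = ψ (x, cu))
    {R : ℕ} (hR : ∀ r, R ≤ r → ψ ((((rm r)⁻¹, 1) : GL (Fin 2) F × GL (Fin 1) F) * (γ m, cu) * (((rm r)⁻¹, 1) : GL (Fin 2) F × GL (Fin 1) F)⁻¹) = 0)
    (k : ℕ) (ρ : Measure (Subgroup.centralizer ({(γ (m + k), cu)} : Set (GL (Fin 2) F × GL (Fin 1) F)))) [ρ.IsHaarMeasure] [ρ.IsInvInvariant]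
    (hρ : ρ (compactCore (Subgroup.centralizer ({(γ (m + k), cu)} : Set (GL (Fin 2) F × GL (Fin 1) F)))) = 1) :
    orbitalIntegral (γ (m + k), cu) ψ (quotientMeasure (Subgroup.centralizer ({(γ (m + k), cu)} : Set (GL (Fin 2) F × GL (Fin 1) F))) ρ
        (isClosed_coe_centralizer_singleton (γ (m + k), cu)) ν) =
      ((ν ((glInt 2 F).prod (glInt 1 F))).toReal : ℂ) *
        (((Nat.card (IsLocalRing.ResidueField 𝒪[F]) : ℂ) ^ k) *
            (∑ r ∈ Finset.range R, ((Nat.card (IsLocalRing.ResidueField 𝒪[F]) : ℂ) ^ r) *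
                ψ ((((rm r)⁻¹, 1) : GL (Fin 2) F × GL (Fin 1) F) * (γ m, cu) * (((rm r)⁻¹, 1) : GL (Fin 2) F × GL (Fin 1) F)⁻¹) +
              ψ (zS, cu) / ((Nat.card (IsLocalRing.ResidueField 𝒪[F]) : ℂ) - 1)) -
          ψ (zS, cu) / ((Nat.card (IsLocalRing.ResidueField 𝒪[F]) : ℂ) - 1)) := by
  classical
  haveI : T2Space F := t2Space_of_isNonarchimedeanLocalField
  have h0 := hϖ.ne_zero
  have hv : v ∈ 𝒪[F] := by rw [Valuation.mem_integer_iff, hv1]; exact hϖ.valuation_le_one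
  have hb : ∀ n : ℕ, (z : F) * ϖ ^ n ≠ 0 := fun n => mul_ne_zero z.ne_zero (pow_ne_zero _ h0)
  have hCn : ∀ n, Subgroup.centralizer ({γ n} : Set (GL (Fin 2) F)) = Subgroup.centralizer ({γτ} : Set (GL (Fin 2) F)) := fun n =>
    centralizer_deep_eq_centralizer_companion (hb n) (hγ n) hγτ
  have hdisc' : ∀ n, (γ n : Matrix (Fin 2) (Fin 2) F).trace ^ 2 - 4 * (γ n : Matrix (Fin 2) (Fin 2) F).det ≠ 0 := fun n => by
    rw [trace_sq_sub_four_mul_det_regRep u v (z : F) (z * ϖ ^ n) (hγ n)]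
    exact mul_ne_zero (pow_ne_zero _ (hb n)) hdisc
  have hOcl : ∀ n, IsClosed {g : GL (Fin 2) F × GL (Fin 1) F | ∃ y : GL (Fin 2) F × GL (Fin 1) F, y * (γ n, cu) * y⁻¹ = g} := fun n =>
    isClosed_conjClass_pair (γ n) (hdisc' n) cu
  -- abbreviations
  set q : ℂ := (Nat.card (IsLocalRing.ResidueField 𝒪[F]) : ℂ) with hq
  set w : ℂ := ((ν ((glInt 2 F).prod (glInt 1 F))).toReal : ℂ) with hw
  have hq1 : q - 1 ≠ 0 := by
    have h1 : (q : ℂ) ≠ 1 := by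
      rw [hq]; exact_mod_cast (Finite.one_lt_card (α := IsLocalRing.ResidueField 𝒪[F])).ne'
    exact sub_ne_zero.2 h1
  have hd : ψ (zS, cu) / (q - 1) * (q - 1) = ψ (zS, cu) := div_mul_cancel₀ _ hq1
  -- THE INDUCTION ON THE DEPTH `m + k`, for every normalised `ρ`
  have key : ∀ k : ℕ, ∀ (ρ : Measure (Subgroup.centralizer ({(γ (m + k), cu)} : Set (GL (Fin 2) F × GL (Fin 1) F))))
      [ρ.IsHaarMeasure] [ρ.IsInvInvariant],
      ρ (compactCore (Subgroup.centralizer ({(γ (m + k), cu)} : Set (GL (Fin 2) F × GL (Fin 1) F)))) = 1 →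
      orbitalIntegral (γ (m + k), cu) ψ (quotientMeasure (Subgroup.centralizer ({(γ (m + k), cu)} : Set (GL (Fin 2) F × GL (Fin 1) F))) ρ
          (isClosed_coe_centralizer_singleton (γ (m + k), cu)) ν) =
        w * (q ^ k * (∑ r ∈ Finset.range R, q ^ r *
                ψ ((((rm r)⁻¹, 1) : GL (Fin 2) F × GL (Fin 1) F) * (γ m, cu) * (((rm r)⁻¹, 1) : GL (Fin 2) F × GL (Fin 1) F)⁻¹) +
              ψ (zS, cu) / (q - 1)) - ψ (zS, cu) / (q - 1)) := by
    intro k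
    induction k with
    | zero =>
      intro ρ _ _ hρ
      have h1 := orbitalIntegral_eq_mul_sum_shell hϖ hu hu1 hv1 hγτ (hCn m) cu hrm (hOcl m) hψc hψs hψK ρ hρ ν hR
      rw [pow_zero, one_mul, add_sub_cancel_right]
      exact h1
    | succ k ih =>
      intro ρ _ _ hρ
      -- support bounds at depths `m + k` and `m + k + 1`
      have hRk : ∀ r, R + k ≤ r →
          ψ ((((rm r)⁻¹, 1) : GL (Fin 2) F × GL (Fin 1) F) * (γ (m + k), cu) * (((rm r)⁻¹, 1) : GL (Fin 2) F × GL (Fin 1) F)⁻¹) = 0 :=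
        apply_shellConj_eq_zero_of_le hϖ hu hv (z : F) cu hγ hrm hm hright hR k
      have hRk1 : ∀ r, R + k + 1 ≤ r →
          ψ ((((rm r)⁻¹, 1) : GL (Fin 2) F × GL (Fin 1) F) * (γ (m + k + 1), cu) * (((rm r)⁻¹, 1) : GL (Fin 2) F × GL (Fin 1) F)⁻¹) = 0 :=
        fun r hr => apply_shellConj_eq_zero_of_le hϖ hu hv (z : F) cu hγ hrm hm hright hR (k + 1) r (by omega)
      have h1 := orbitalIntegral_eq_mul_sum_shell hϖ hu hu1 hv1 hγτ (hCn (m + k + 1)) cu hrm (hOcl (m + k + 1)) hψc hψs hψK ρ hρ ν hRk1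
      refine h1.trans ?_
      -- unfold the last shell sum: `S_{m+k+1} = q·S_{m+k} + ψ(z·1₂, c)`
      rw [Finset.sum_range_succ', pow_zero, one_mul, apply_shellConj_succ_zero_eq hϖ hu hv (z : F) cu hγ hrm hzS hright (Nat.le_add_right m k)]
      have hshift : ∀ r, ψ ((((rm (r + 1))⁻¹, 1) : GL (Fin 2) F × GL (Fin 1) F) * (γ (m + k + 1), cu) * (((rm (r + 1))⁻¹, 1) : GL (Fin 2) F × GL (Fin 1) F)⁻¹) =
          ψ ((((rm r)⁻¹, 1) : GL (Fin 2) F × GL (Fin 1) F) * (γ (m + k), cu) * (((rm r)⁻¹, 1) : GL (Fin 2) F × GL (Fin 1) F)⁻¹) := fun r =>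
        apply_shellConj_succ_succ_eq hϖ hu hv (z : F) cu hγ hrm hm hright (Nat.le_add_right m k) r
      simp_rw [hshift]
      have hS' : ∑ r ∈ Finset.range (R + k), q ^ (r + 1) *
            ψ ((((rm r)⁻¹, 1) : GL (Fin 2) F × GL (Fin 1) F) * (γ (m + k), cu) * (((rm r)⁻¹, 1) : GL (Fin 2) F × GL (Fin 1) F)⁻¹) =
          q * ∑ r ∈ Finset.range (R + k), q ^ r *
            ψ ((((rm r)⁻¹, 1) : GL (Fin 2) F × GL (Fin 1) F) * (γ (m + k), cu) * (((rm r)⁻¹, 1) : GL (Fin 2) F × GL (Fin 1) F)⁻¹) := by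
        rw [Finset.mul_sum]
        exact Finset.sum_congr rfl fun r _ => by ring
      rw [hS']
      -- the shell sum at depth `m + k` is an orbital integral (for SOME normalised `ρ'`), known by the induction hypothesis
      haveI : LocallyCompactSpace (Subgroup.centralizer ({(γ (m + k), cu)} : Set (GL (Fin 2) F × GL (Fin 1) F))) :=
        (isClosed_coe_centralizer_singleton (γ (m + k), cu)).isClosedEmbedding_subtypeVal.locallyCompactSpace
      obtain ⟨ρ', hρ'1, hρ'2, hρ'3⟩ := exists_isHaarMeasure_compactCore_centralizer_pair_eq_one hϖ hu hu1 hv1 hγτ (hCn (m + k)) cu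
      haveI := hρ'1
      haveI := hρ'2
      have hIH := ih ρ' hρ'3
      rw [orbitalIntegral_eq_mul_sum_shell hϖ hu hu1 hv1 hγτ (hCn (m + k)) cu hrm (hOcl (m + k)) hψc hψs hψK ρ' hρ'3 ν hRk] at hIH
      linear_combination q * hIH + (-w) * hd
  exact key k ρ hρ

end Engine


end Summit.HodgeConjecture.HodgeConjecture.Cruxes.H413.K2E3GLTwoRamifiedRayGermEngine

end
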